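import Mathlib
import HarnessLib
import Literature.MathematicalPhysics.StatisticalMechanics.RenormalisationMapBlockDefect

/-!
# The single-block defect of `K_{k+1}` with a free `H̃` — `U`-FREE (block) form of the constant ([ABKM19] Ch. 9.1 / Ch. 10.1)

`RenormalisationMapBlockDefect.tayNormLE_blockDefect_sub_abkm` bounds `Σ_{B̄ = U} p_B(H̃)(e^{−H₁(B)} − e^{−H₂(B)})` by
`|U|_k κ^{|U|_k}·16e^{3/8}‖H₁ − H₂‖_{k,0}`.  The sum is empty unless `U` is a single `(k+1)`-block (the closure of a `k`-block),
in which case `|U|_k = L^d` and `A·A^{−|U|_{k+1}} = 1`; hence the same bound holds with the `U`-free constant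
`L^d κ^{L^d}·16e^{3/8}‖H₁ − H₂‖_{k,0}·(A·A^{−|U|_{k+1}})` — the shape in which the weak-norm (`‖·‖_{k+1}^{(A)}`) assembly of the
free-`H̃` bounds consumes the single-block pieces (as `RenormalisationMapRemainderOneBlockFree` does for `Σ₁`).

* `tayNormLE_blockDefect_sub_abkm_blockFree`.

Everything is proved; no named fact.  Honest scope: blocks B1–B3 of the stub `stub_f4l2ShrinkLoc` of the rung route
`Summits/HubbardSuperconductivity/…/Theses/ComplexGFFStiffness`; nothing about superconductivity in the Hubbard model is claimed.

## References
* S. Adams, S. Buchholz, R. Kotecký, S. Müller, arXiv:1910.13564 — Theorem 6.8, Ch. 9.1, Ch. 10.1 (10.3)–(10.5), Lemma 9.3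
  [AdamsBuchholzKoteckyMuller2019].
-/

noncomputable section

namespace Literature.MathematicalPhysics.StatisticalMechanics.GradientRG

open scoped BigOperators Classical
open Finset Matrix MeasureTheory
open Literature.MathematicalPhysics.StatisticalMechanics.TorusPolymer
  (IsPolymer blocks polys bprod blockOf thicken reblock boxCorner mem_polys mem_blocks numBlocks isPolymer_blockOf
    card_blocks_eq_numBlocks blocks_blockOf empty_mem_polys reblock_empty subset_thicken
    bprod_empty blocks_empty blocks_mono closure)
open Literature.Barriers.CriticalPhenomena.LongRangePhi4.Polymer (IsConn components)
open Literature.MathematicalPhysics.QuantumFieldTheory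

variable {d M : ℕ} [NeZero M]

set_option maxHeartbeats 400000 in
/-- **The single-block defect bound, block form** (module docstring): hypotheses of `tayNormLE_blockDefect_sub_abkm` and `A ≥ 1`;
constant `L^d κ^{L^d}·16e^{3/8}‖H₁ − H₂‖_{k,0}·(A·A^{−|U|_{k+1}})`.
[cite: AdamsBuchholzKoteckyMuller2019, Lemma 9.3 (9.13) / Theorem 6.8 / Ch. 10.1 (10.3)–(10.5)] -/
theorem tayNormLE_blockDefect_sub_abkm_blockFree {L N Mord R n p r₀ : ℕ} {θbar lam μ δ₁ δ₀ A𝒫 h A : ℝ}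
    {𝒞 : ℕ → (Fin d → ZMod M) → ℝ} (hd : 3 ≤ d) (hLodd : Odd L) (hL : 2 ^ (d + 3) + 16 * R ≤ L)
    (hR2 : 2 ≤ R) (hM : M = L ^ N) {k : ℕ} (hkN : k + 1 ≤ N) (hp : d / 2 + 1 ≤ p) (hMord : d / 2 + 1 ≤ Mord)
    (hB : AbkmWeightBounds L N Mord R n θbar lam μ δ₁ δ₀ A𝒫 𝒞
      (abkmWeightData L N Mord R θbar (schedDelta δ₀ δ₁ N) 𝒞))
    (hδ₀ : 0 < δ₀) (hδ₁ : 0 < δ₁) (hh : 0 < h) (hh0 : hZeroSq d R δ₀ δ₁ ≤ h ^ 2) (hA1 : 1 ≤ A)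
    (D : StepData d M) (hDs : D.s = L ^ k) (hDL : D.L = L)
    {U : Finset (Fin d → ZMod M)} (hU : IsPolymer (L ^ (k + 1)) U)
    {Ht H₁ H₂ : RelevantHamiltonian ℂ d} {τ : ℝ}
    (hHt : hamNorm (fieldWt h (L : ℝ) d k) ((L : ℝ) ^ k) (L ^ (d * k)) Ht ≤ τ) (hτ : τ ≤ 1 / 16)
    (hH₁ : hamNorm (fieldWt h (L : ℝ) d k) ((L : ℝ) ^ k) (L ^ (d * k)) H₁ ≤ 1 / 16)
    (hH₂ : hamNorm (fieldWt h (L : ℝ) d k) ((L : ℝ) ^ k) (L ^ (d * k)) H₂ ≤ 1 / 16)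
    {κ : ℝ} (hκ : 1 + Real.exp (1 / 4) ≤ κ) :
    TayNormLE ((abkmNormParams L N Mord R p r₀ h θbar A (schedDelta δ₀ δ₁ N) 𝒞).gauge (k + 1) U) r₀
      ((abkmWeightData L N Mord R θbar (schedDelta δ₀ δ₁ N) 𝒞).weight (k + 1) U)
      (fun φ => ∑ B ∈ blockPartIndex D U,
        bprod (L ^ k) (fun B' => expNegH Ht B' φ) (U \ B) *
            bprod (L ^ k) (fun B' => expNegH (-Ht) B' φ) (B \ U) *
          (expNegH H₁ B φ - expNegH H₂ B φ))
      (((L ^ d : ℕ) : ℝ) * κ ^ (L ^ d) *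
        (16 * Real.exp (3 / 8) *
          hamNorm (fieldWt h (L : ℝ) d k) ((L : ℝ) ^ k) (L ^ (d * k)) (H₁ - H₂)) *
        (A * (abkmNormParams L N Mord R p r₀ h θbar A (schedDelta δ₀ δ₁ N) 𝒞).aFactor (k + 1) U)) := by
  set P := abkmNormParams L N Mord R p r₀ h θbar A (schedDelta δ₀ δ₁ N) 𝒞 with hP
  set W := abkmWeightData L N Mord R θbar (schedDelta δ₀ δ₁ N) 𝒞 with hW
  have hL0 : (0 : ℝ) < L := by exact_mod_cast hLodd.pos
  have hA0 : 0 < A := by linarith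
  have hsodd : Odd (L ^ k) := hLodd.pow
  have h𝔥 : 0 < fieldWt h (L : ℝ) d k := fieldWt_pos hh hL0 d k
  have hRk : (0 : ℝ) < (L : ℝ) ^ k := by positivity
  have hnn : ∀ G : RelevantHamiltonian ℂ d, 0 ≤ hamNorm (fieldWt h (L : ℝ) d k) ((L : ℝ) ^ k) (L ^ (d * k)) G :=
    fun G => hamNorm_nonneg h𝔥.le hRk.le _ _
  have h1 := tayNormLE_blockDefect_sub_abkm (n := n) (lam := lam) (μ := μ) (A𝒫 := A𝒫) (p := p) (r₀ := r₀) (A := A) hd hLodd hL hR2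
    hM hkN hp hMord hB hδ₀ hδ₁ hh hh0 D hDs hDL hU hHt hτ hH₁ hH₂ hκ
  by_cases hne : (blockPartIndex D U).Nonempty
  · obtain ⟨B, hB'⟩ := hne
    have hcl := (mem_filter.1 hB').2
    have hBb := (mem_filter.1 hB').1
    rw [hDs] at hBb
    obtain ⟨x, -, rfl⟩ := mem_blocks.1 hBb
    rw [hDs, hDL, closure_blockOf_mul hsodd hLodd x] at hcl
    have hcard1 : (blocks (L * L ^ k) U).card = 1 := by rw [← hcl, blocks_blockOf, card_singleton]
    have hnb : numBlocks (P.L ^ (k + 1)) U = 1 := by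
      show numBlocks (L ^ (k + 1)) U = 1
      rw [← card_blocks_eq_numBlocks, pow_succ', hcard1]
    have haF : A * P.aFactor (k + 1) U = 1 := by
      show A * (A ^ numBlocks (P.L ^ (k + 1)) U)⁻¹ = 1
      rw [hnb, pow_one, mul_inv_cancel₀ hA0.ne']
    have hMeq : M = L * L ^ k * L ^ (N - k - 1) := by
      rw [hM, ← pow_succ', ← pow_add]; congr 1; omega
    have hU' : IsPolymer (L * L ^ k) U := by rw [← pow_succ']; exact hU
    have hm0 : (blocks (L ^ k) U).card = L ^ d := by
      rw [TorusPolymer.card_blocks_eq_mul hMeq hsodd hLodd hLodd.pow hU', hcard1, mul_one]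
    rw [hm0] at h1
    rw [haF, mul_one]
    exact h1
  · rw [not_nonempty_iff_eq_empty] at hne
    intro φ
    have hF : (fun φ => ∑ B ∈ blockPartIndex D U,
        bprod (L ^ k) (fun B' => expNegH Ht B' φ) (U \ B) *
            bprod (L ^ k) (fun B' => expNegH (-Ht) B' φ) (B \ U) *
          (expNegH H₁ B φ - expNegH H₂ B φ)) = fun _ => (0 : ℂ) := by
      funext ψ; rw [hne, sum_empty]
    rw [hF, tayNorm_const, norm_zero]
    have hκ0 : 0 ≤ κ := by linarith [hκ, Real.exp_pos (1 / 4)]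
    have haF0 : 0 ≤ P.aFactor (k + 1) U := (WeakNormLE.aFactor_pos hA0 (k + 1) U).le
    have hw0 := (W.weight_pos (k + 1) U φ).le
    have hρ0 : 0 ≤ 16 * Real.exp (3 / 8) * hamNorm (fieldWt h (L : ℝ) d k) ((L : ℝ) ^ k) (L ^ (d * k)) (H₁ - H₂) := by
      have := hnn (H₁ - H₂); positivity
    have hLd : (0 : ℝ) ≤ ((L ^ d : ℕ) : ℝ) := Nat.cast_nonneg _
    exact mul_nonneg (mul_nonneg (mul_nonneg (mul_nonneg hLd (pow_nonneg hκ0 _)) hρ0) (mul_nonneg hA0.le haF0)) hw0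

end Literature.MathematicalPhysics.StatisticalMechanics.GradientRG

end
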